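import Mathlib
import HarnessLib
import Summits.MatrixMultiplication.MatrixMultiplication.Theorems.OutsiderSandwichCapSetFloors
import Summits.MatrixMultiplication.MatrixMultiplication.Theorems.OutsiderSandwichPackFloors

/-!
# A directional cap set of size `102` in `𝔽₃^5`: `Q_ℂ(cw₂^{⊠5}) ≥ 102`

Third part of K41 (helper for `LaserTangency`, route OutsiderSandwich; lens «minimal counterexample /
extremal reduction» of the `decomp-mm` cell).  `OutsiderSandwichCapSetLift` reduced free diagonals of
`cw₂^{⊠N}` over `ℂ` to **directional cap sets** `A ⊂ 𝔽₃^N` (no `x, x+d, x+2d ∈ A` with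
`d ∈ {0,1}^N ∖ 0`) via `diagPow_restrictsTo_unitTensor_of_dirCapFree`, and produced them by lifting
ordinary caps.  At `N = 5` the lift gives only `81` and the tree floor is `84 = 14·6`
(`OutsiderSandwichPackFloors.cwPow_five_restrictsTo_unitEightyFour`).  A randomized local search at
this node (remove one or two points, refill greedily; four independent runs, each converging within
seconds) finds a directional cap set of size **`102`** in `𝔽₃^5`; the slice bound
`dircap(5) ≤ 3·dircap(4) = 3·36 = 108` (exact value `36` at `N = 4` by exhaustive search at this
node, not formalised) leaves a gap of `6`.

Structure of the set (data, not used in the proofs): its stabiliser in the monomial-affine group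
`(𝔽₃ ⋊ {±1})^5 ⋊ S₅` is a copy of `A₅` acting **without fixed points**
(`σ ↦ (x ↦ σ·x + c_σ)`, all `60` even permutations, no sign changes; generated by
`x ↦ (x₀+1, x₁+2, x₃+2, x₄+2, x₂+2)` and `x ↦ (x₁+1, x₂, x₀+2, x₃+1, x₄+2)`), which cuts `𝔽₃^5`
into `12` orbits of sizes `6,6,6,15,15,15,30,…,30`; the set is the union of six of them
(`30+30+15+15+6+6`, representatives `00102, 00101, 00121, 00122, 01221, 00202`).

Certificate: `exists_dirCapFree_card_102` checks the pair form of directional-cap-freeness by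
`decide +kernel` against a `3^5`-entry Boolean membership table (`dirCapFree_of_table` turns it into
the hypothesis of the lift theorem; ≈ 40 s of kernel time).  Consequences:

| statement | here | tree before |
|---|---|---|
| `Q_ℂ(cw₂^{⊠5}) ≥` | `102` | `84` (`PackFloors`) — ceiling `219` (`HammingBound`) |
| `Q_ℂ(cw₂^{⊠7}) ≥` | `612 = 102·6` | `540` (`CapSetFloors`) |
| `Q_ℂ(cw₂^{⊠9}) ≥` | `3672 = 102·36` | `3645` (`CapSetFloors`) |
| `(6,2)`: `B·⟨2,2,2⟩ ≤ cw₂^{⊠6}` | `B = 51` | `42` (`PackFloors`) |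
| `(8,2)`, `(9,2)`, `(10,2)` | `306`, `810`, `1836` | — |
| `(8,3)`, `(9,3)`, `(10,3)`: `B·⟨3,3,3⟩` | `102`, `243`, `612` | — |
| `(9,4)`, `(10,4)`: `B·⟨4,4,4⟩` | `102`, `243` | — |

(`N = 6, 8, 10` keep the cap-lift floors `243, 1620, 10935`; `102·102 = 10404 < 10935`.)
Like `OutsiderSandwichCapSetLift`/`Floors` this file sits inside the import cone of the route file
(through `OutsiderSandwichCwCubeSubrank`); it uses no route item.

Honest tag: WEAKER·INSTRUMENT (finite census floors; the asymptotic rate `102^{1/5} ≈ 2.522` is below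
the cap-lift rate and below `Q̃_ℂ(cw₂) = 3`).

References: M. Christandl, P. Vrana, J. Zuiddam, J. Amer. Math. Soc. 36 (2023), §2.1
[ChristandlVranaZuiddam2021]; J. S. Ellenberg, D. Gijswijt, Ann. Math. 185 (2017) [EllenbergGijswijt2017];
V. Strassen, J. reine angew. Math. 413 (1991) [Strassen1991].
-/

namespace Summit.MatrixMultiplication.MatrixMultiplication.Theorems.OutsiderSandwichDirCapFive

open Literature.Computability.AlgebraicComplexity
open Literature.Barriers.MatrixMultiplication
open Summit.MatrixMultiplication.MatrixMultiplication.Theorems.OutsiderSandwichCwCubeSubrank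
  (cwTwo_restrictsTo_diag)
open Summit.MatrixMultiplication.MatrixMultiplication.Theorems.OutsiderSandwichCapSetLift
open Summit.MatrixMultiplication.MatrixMultiplication.Theorems.OutsiderSandwichCapSetFloors
  (floor_six floor_eight)
open Summit.MatrixMultiplication.MatrixMultiplication.Theorems.OutsiderSandwichPackFloors
  (pack_two_of_diagonal pack_of_diagonal_of_mm diagonal_mul cwPow_two_restrictsTo_unitSix_complex
    cwPow_four_restrictsTo_unitThirtySix mmInCwTwoPow_four_four)
open Summit.MatrixMultiplication.MatrixMultiplication.Theorems.CwCubeHostsMMThree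
  (mmInCwTwoPow_three_three)

/-! ## 1. Table certificates for directional cap sets -/

/-- **Table certificate.**  If a Boolean table `T` contains `A` (`T z = true` on `A`) and, for all
`x ≠ y` in `A` with `y − x ∈ {0,1}^N`, the third point `y + (y − x)` of the progression lies outside
`T`, then `A` is a directional cap set in the form consumed by
`OutsiderSandwichCapSetLift.diagPow_restrictsTo_unitTensor_of_dirCapFree`.  (Membership in `A` is a
linear scan for `decide`; the table makes the inner test constant-time.) [new] -/
theorem dirCapFree_of_table {N : ℕ} (A : Finset (Fin N → Fin 3)) (T : (Fin N → Fin 3) → Bool)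
    (hT : ∀ z ∈ A, T z = true)
    (hP : ∀ x ∈ A, ∀ y ∈ A, (∀ m, (y - x) m = 0 ∨ (y - x) m = 1) → x ≠ y →
      T (y + (y - x)) = false) :
    ∀ x ∈ A, ∀ d : Fin N → Fin 3, (∀ m, d m = 0 ∨ d m = 1) →
      x + d ∈ A → x + d + d ∈ A → d = 0 := by
  intro x hx d hd h1 h2
  by_contra hne
  have hxy : x ≠ x + d := fun h => hne (left_eq_add.mp h)
  have hbin : ∀ m, (x + d - x) m = 0 ∨ (x + d - x) m = 1 := by
    simpa only [add_sub_cancel_left] using hd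
  have hp := hP x hx (x + d) h1 hbin hxy
  rw [add_sub_cancel_left, hT _ h2] at hp
  exact Bool.noConfusion hp

/-- **A directional cap set of size `102` in `𝔽₃^5`** (found by local search at this node; the
`A₅`-symmetric set of the module docstring), certified by `decide +kernel` through
`dirCapFree_of_table`. [new] -/
theorem exists_dirCapFree_card_102 : ∃ A : Finset (Fin 5 → Fin 3), A.card = 102 ∧
    ∀ x ∈ A, ∀ d : Fin 5 → Fin 3, (∀ m, d m = 0 ∨ d m = 1) →
      x + d ∈ A → x + d + d ∈ A → d = 0 := by
  refine ⟨{![0, 0, 1, 0, 1], ![0, 0, 1, 0, 2], ![0, 0, 1, 2, 1], ![0, 0, 1, 2, 2], ![0, 0, 2, 0, 1], ![0, 0, 2, 0, 2],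
    ![0, 0, 2, 2, 1], ![0, 0, 2, 2, 2], ![0, 1, 0, 1, 0], ![0, 1, 0, 1, 2], ![0, 1, 0, 2, 0], ![0, 1, 0, 2, 2],
    ![0, 1, 1, 1, 1], ![0, 1, 1, 1, 2], ![0, 1, 1, 2, 1], ![0, 1, 1, 2, 2], ![0, 1, 2, 1, 0], ![0, 1, 2, 1, 1],
    ![0, 1, 2, 2, 0], ![0, 1, 2, 2, 1], ![0, 2, 0, 1, 0], ![0, 2, 0, 1, 2], ![0, 2, 0, 2, 0], ![0, 2, 0, 2, 2],
    ![0, 2, 1, 0, 1], ![0, 2, 1, 0, 2], ![0, 2, 1, 1, 1], ![0, 2, 1, 1, 2], ![0, 2, 2, 0, 1], ![0, 2, 2, 0, 2],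
    ![0, 2, 2, 1, 0], ![0, 2, 2, 1, 1], ![0, 2, 2, 2, 0], ![0, 2, 2, 2, 2], ![1, 0, 0, 0, 0], ![1, 0, 0, 0, 1],
    ![1, 0, 0, 1, 0], ![1, 0, 0, 1, 2], ![1, 0, 0, 2, 1], ![1, 0, 0, 2, 2], ![1, 0, 1, 0, 0], ![1, 0, 1, 0, 1],
    ![1, 0, 1, 1, 0], ![1, 0, 1, 1, 2], ![1, 0, 1, 2, 1], ![1, 0, 1, 2, 2], ![1, 1, 0, 0, 0], ![1, 1, 0, 0, 1],
    ![1, 1, 0, 1, 0], ![1, 1, 0, 1, 2], ![1, 1, 0, 2, 1], ![1, 1, 0, 2, 2], ![1, 1, 1, 1, 1], ![1, 1, 1, 1, 2],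
    ![1, 1, 1, 2, 1], ![1, 1, 1, 2, 2], ![1, 1, 2, 0, 0], ![1, 1, 2, 0, 1], ![1, 1, 2, 1, 0], ![1, 1, 2, 1, 1],
    ![1, 2, 1, 0, 0], ![1, 2, 1, 0, 1], ![1, 2, 1, 1, 0], ![1, 2, 1, 1, 1], ![1, 2, 2, 0, 0], ![1, 2, 2, 0, 1],
    ![1, 2, 2, 1, 0], ![1, 2, 2, 1, 1], ![2, 0, 0, 0, 0], ![2, 0, 0, 0, 1], ![2, 0, 0, 1, 0], ![2, 0, 0, 1, 2],
    ![2, 0, 0, 2, 1], ![2, 0, 0, 2, 2], ![2, 0, 1, 0, 0], ![2, 0, 1, 0, 2], ![2, 0, 1, 1, 0], ![2, 0, 1, 1, 2],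
    ![2, 0, 2, 0, 1], ![2, 0, 2, 0, 2], ![2, 0, 2, 2, 1], ![2, 0, 2, 2, 2], ![2, 1, 0, 0, 0], ![2, 1, 0, 0, 1],
    ![2, 1, 0, 2, 0], ![2, 1, 0, 2, 1], ![2, 1, 2, 0, 0], ![2, 1, 2, 0, 1], ![2, 1, 2, 2, 0], ![2, 1, 2, 2, 1],
    ![2, 2, 0, 1, 0], ![2, 2, 0, 1, 2], ![2, 2, 0, 2, 0], ![2, 2, 0, 2, 2], ![2, 2, 1, 0, 0], ![2, 2, 1, 0, 2],
    ![2, 2, 1, 1, 0], ![2, 2, 1, 1, 2], ![2, 2, 2, 0, 0], ![2, 2, 2, 0, 2], ![2, 2, 2, 2, 0], ![2, 2, 2, 2, 2]}, by decide +kernel, dirCapFree_of_table _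
    (fun z => (![![![![![false, false, false], ![false, false, false], ![false, false, false]], ![![false,
      true, true], ![false, false, false], ![false, true, true]], ![![false, true, true],
      ![false, false, false], ![false, true, true]]], ![![![false, false, false], ![true, false,
      true], ![true, false, true]], ![![false, false, false], ![false, true, true], ![false,
      true, true]], ![![false, false, false], ![true, true, false], ![true, true, false]]],
      ![![![false, false, false], ![true, false, true], ![true, false, true]], ![![false, true,
      true], ![false, true, true], ![false, false, false]], ![![false, true, true], ![true,
      true, false], ![true, false, true]]]], ![![![![true, true, false], ![true, false, true],
      ![false, true, true]], ![![true, true, false], ![true, false, true], ![false, true,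
      true]], ![![false, false, false], ![false, false, false], ![false, false, false]]],
      ![![![true, true, false], ![true, false, true], ![false, true, true]], ![![false, false,
      false], ![false, true, true], ![false, true, true]], ![![true, true, false], ![true, true,
      false], ![false, false, false]]], ![![![false, false, false], ![false, false, false],
      ![false, false, false]], ![![true, true, false], ![true, true, false], ![false, false,
      false]], ![![true, true, false], ![true, true, false], ![false, false, false]]]],
      ![![![![true, true, false], ![true, false, true], ![false, true, true]], ![![true, false,
      true], ![true, false, true], ![false, false, false]], ![![false, true, true], ![false,
      false, false], ![false, true, true]]], ![![![true, true, false], ![false, false, false],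
      ![true, true, false]], ![![false, false, false], ![false, false, false], ![false, false,
      false]], ![![true, true, false], ![false, false, false], ![true, true, false]]],
      ![![![false, false, false], ![true, false, true], ![true, false, true]], ![![true, false,
      true], ![true, false, true], ![false, false, false]], ![![true, false, true], ![false,
      false, false], ![true, false, true]]]]] : Fin 3 → Fin 3 → Fin 3 → Fin 3 → Fin 3 → Bool)
      (z 0) (z 1) (z 2) (z 3) (z 4)) ?_ ?_⟩
  · decide +kernel
  · decide +kernel

/-! ## 2. Subrank floors at `N = 5, 7, 9` -/

/-- **`cw₂^{⊠5} ≥ ⟨102⟩`** over `ℂ` (tree floor `84`, `OutsiderSandwichPackFloors`; Hamming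
ceiling `219`, Part-I window ceiling `227`). [new] -/
theorem floor_five : TensorRestrictsTo (kroneckerPow (cwTensor ℂ 2) 5) (unitTensor ℂ 102) ∧
    102 ≤ subrank ℂ (kroneckerPow (cwTensor ℂ 2) 5) := by
  obtain ⟨A, hc, hA⟩ := exists_dirCapFree_card_102
  have hD : ∀ a b c : Fin 3, (fun a b c : Fin 3 => if a ≠ b ∧ b ≠ c ∧ a ≠ c then (1 : ℂ) else 0)
      a b c = if a ≠ b ∧ b ≠ c ∧ a ≠ c then 1 else 0 := fun _ _ _ => rfl
  have h := ((cwTwo_restrictsTo_diag hD).kroneckerPow 5).trans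
    (diagPow_restrictsTo_unitTensor_of_dirCapFree hD A hA)
  rw [hc] at h
  exact ⟨h, le_subrank_of_restrictsTo h⟩

/-- **`cw₂^{⊠7} ≥ ⟨612⟩`** over `ℂ` (`612 = 102·6`; previous floor `540`,
`OutsiderSandwichCapSetFloors.floor_seven`; Hamming ceiling `2091`). [new] -/
theorem floor_seven : TensorRestrictsTo (kroneckerPow (cwTensor ℂ 2) 7) (unitTensor ℂ 612) ∧
    612 ≤ subrank ℂ (kroneckerPow (cwTensor ℂ 2) 7) :=
  have h := diagonal_mul floor_five.1 cwPow_two_restrictsTo_unitSix_complex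
  ⟨h, le_subrank_of_restrictsTo h⟩

/-- **`cw₂^{⊠9} ≥ ⟨3672⟩`** over `ℂ` (`3672 = 102·36`; previous floor `3645`,
`OutsiderSandwichCapSetFloors.floor_nine`; Hamming ceiling `19299`). [new] -/
theorem floor_nine : TensorRestrictsTo (kroneckerPow (cwTensor ℂ 2) 9) (unitTensor ℂ 3672) ∧
    3672 ≤ subrank ℂ (kroneckerPow (cwTensor ℂ 2) 9) :=
  have h := diagonal_mul floor_five.1 cwPow_four_restrictsTo_unitThirtySix
  ⟨h, le_subrank_of_restrictsTo h⟩

/-- The census floors `Q_ℂ(cw₂^{⊠N}) ≥ 102, 243, 612, 1620, 3672, 10935` for `N = 5, …, 10` after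
K41 (the even entries are `OutsiderSandwichCapSetFloors.subrank_floors`). [new] -/
theorem subrank_floors :
    102 ≤ subrank ℂ (kroneckerPow (cwTensor ℂ 2) 5) ∧
      612 ≤ subrank ℂ (kroneckerPow (cwTensor ℂ 2) 7) ∧
        3672 ≤ subrank ℂ (kroneckerPow (cwTensor ℂ 2) 9) :=
  ⟨floor_five.2, floor_seven.2, floor_nine.2⟩

/-! ## 3. Packing cells `B·⟨m,m,m⟩ ≤ cw₂^{⊠N}` fed by the new diagonals -/

/-- `(6,2)`: `51·⟨2,2,2⟩ ≤ cw₂^{⊠6}` (`102 = 51·2` at `N = 5`; tree floor `42`,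
`OutsiderSandwichPackFloors.pack_fortytwo_two_le_cwPow_six`). [new] -/
theorem pack_51_mmTwo_le_cwPow_6 : TensorRestrictsTo (kroneckerPow (cwTensor ℂ 2) 6)
    (kroneckerTensor (unitTensor ℂ 51) (matMulTensor ℂ 2 2 2)) :=
  pack_two_of_diagonal floor_five.1

/-- `(8,2)`: `306·⟨2,2,2⟩ ≤ cw₂^{⊠8}` (`612 = 306·2` at `N = 7`). [new] -/
theorem pack_306_mmTwo_le_cwPow_8 : TensorRestrictsTo (kroneckerPow (cwTensor ℂ 2) 8)
    (kroneckerTensor (unitTensor ℂ 306) (matMulTensor ℂ 2 2 2)) :=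
  pack_two_of_diagonal floor_seven.1

/-- `(9,2)`: `810·⟨2,2,2⟩ ≤ cw₂^{⊠9}` (`1620 = 810·2` at `N = 8`,
`OutsiderSandwichCapSetFloors.floor_eight`). [new] -/
theorem pack_810_mmTwo_le_cwPow_9 : TensorRestrictsTo (kroneckerPow (cwTensor ℂ 2) 9)
    (kroneckerTensor (unitTensor ℂ 810) (matMulTensor ℂ 2 2 2)) :=
  pack_two_of_diagonal floor_eight.1

/-- `(10,2)`: `1836·⟨2,2,2⟩ ≤ cw₂^{⊠10}` (`3672 = 1836·2` at `N = 9`). [new] -/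
theorem pack_1836_mmTwo_le_cwPow_10 : TensorRestrictsTo (kroneckerPow (cwTensor ℂ 2) 10)
    (kroneckerTensor (unitTensor ℂ 1836) (matMulTensor ℂ 2 2 2)) :=
  pack_two_of_diagonal floor_nine.1

/-- `(8,3)`: `102·⟨3,3,3⟩ ≤ cw₂^{⊠8}` (`⟨102⟩ ≤ cw₂^{⊠5}` times `I(3,3)`). [new] -/
theorem pack_102_mmThree_le_cwPow_8 : TensorRestrictsTo (kroneckerPow (cwTensor ℂ 2) 8)
    (kroneckerTensor (unitTensor ℂ 102) (matMulTensor ℂ 3 3 3)) :=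
  pack_of_diagonal_of_mm floor_five.1 (mmInCwTwoPow_three_three ℂ)

/-- `(9,3)`: `243·⟨3,3,3⟩ ≤ cw₂^{⊠9}` (`⟨243⟩ ≤ cw₂^{⊠6}` times `I(3,3)`). [new] -/
theorem pack_243_mmThree_le_cwPow_9 : TensorRestrictsTo (kroneckerPow (cwTensor ℂ 2) 9)
    (kroneckerTensor (unitTensor ℂ 243) (matMulTensor ℂ 3 3 3)) :=
  pack_of_diagonal_of_mm floor_six.1 (mmInCwTwoPow_three_three ℂ)

/-- `(10,3)`: `612·⟨3,3,3⟩ ≤ cw₂^{⊠10}` (`⟨612⟩ ≤ cw₂^{⊠7}` times `I(3,3)`). [new] -/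
theorem pack_612_mmThree_le_cwPow_10 : TensorRestrictsTo (kroneckerPow (cwTensor ℂ 2) 10)
    (kroneckerTensor (unitTensor ℂ 612) (matMulTensor ℂ 3 3 3)) :=
  pack_of_diagonal_of_mm floor_seven.1 (mmInCwTwoPow_three_three ℂ)

/-- `(9,4)`: `102·⟨4,4,4⟩ ≤ cw₂^{⊠9}` (`⟨102⟩ ≤ cw₂^{⊠5}` times `I(4,4)`). [new] -/
theorem pack_102_mmFour_le_cwPow_9 : TensorRestrictsTo (kroneckerPow (cwTensor ℂ 2) 9)
    (kroneckerTensor (unitTensor ℂ 102) (matMulTensor ℂ 4 4 4)) :=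
  pack_of_diagonal_of_mm floor_five.1 mmInCwTwoPow_four_four

/-- `(10,4)`: `243·⟨4,4,4⟩ ≤ cw₂^{⊠10}` (`⟨243⟩ ≤ cw₂^{⊠6}` times `I(4,4)`). [new] -/
theorem pack_243_mmFour_le_cwPow_10 : TensorRestrictsTo (kroneckerPow (cwTensor ℂ 2) 10)
    (kroneckerTensor (unitTensor ℂ 243) (matMulTensor ℂ 4 4 4)) :=
  pack_of_diagonal_of_mm floor_six.1 mmInCwTwoPow_four_four

end Summit.MatrixMultiplication.MatrixMultiplication.Theorems.OutsiderSandwichDirCapFive
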